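import Summits.NavierStokesRegularity.NavierStokesRegularity.Theorems.StrainDoorsSliceConcentrationCriterionCore
import Literature.Analysis.FluidPDE.KatoLocalBoundedPicard
import Literature.Analysis.FluidPDE.KNSSRemark61
import HarnessLib

/-!
# Strain doors, PART M §M32(a)–(b) — the zoom with the slice at `−4q²`; forward uniqueness of a constant
# slice in the Type-I ancient mild class

ROUND 71 of the `ns-regularity-ideate` p1 line (helper lane of `stmt-NavierStokesRegularity-0056`, rung N0;
nothing here is a claim about Navier–Stokes regularity — a-priori STRUCTURE of a HYPOTHETICAL singularity of a
solution which is Type I in the sup-norm; nothing about Type II).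

PART M §M32 — door **Y∞**: at a singular point `(T,x₀)` of a classical Leray–Hopf solution with the global
sup-norm Type-I bound `|u| ≤ M/√(T − t)`, for ALL `t` close to `T` the parabolic ball `B(x₀, R(M)√(T − t))`
contains a point with `(T − t)|ω(x,t)| ≥ d(M)` — constants depending on `M` ONLY (the quantitative, `M`-only,
every-time form of Barker–Prange 2020 (5.3), and the non-vacuity half of the `δ₀`-criterion of ROUNDS 68/70).
Mechanism: bad slices ⇒ zoom with the slice placed at `−4q²` (§M32(a)) ⇒ `U ∈ A_M` with small vorticity on a
large ball at `−4q²` AND — door X (ROUND 70, `M`-only every-time `L³` concentration) at the rescaled time `−2`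
— definite `L³` mass at `−2` ⇒ second compactness in `A_M` ⇒ `W` with `curl W(−4q²) ≡ 0` ⇒ `W(−4q²) ≡ c`
(curl-free Liouville) ⇒ LEMMA F (§M32(b), forward uniqueness of a constant slice in `A_M`) `W(−2) ≡ c`,
`|c| ≤ M/(2q)` ⇒ mass `|c|³·|B̄| < γ(M)` for `q = q(M)`: contradiction (§M32(c)–(d)).

THIS FILE (text N12a): §M32(a) `exists_zoomLimit_at_singular_along_scaled` (the tree engine
`LocalTypeIBlowup.exists_typeIAncientMild_zoomLimit` at a singular vertex along `λ_j = √(T − s_j)/(2q)`, pointwise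
convergence of velocities and vorticities at every rescaled time `σ < −1`); §M32(b) `typeIAncientMild_forward_const`
(LEMMA F: `U ∈ A_C`, `U(s) ≡ c` ⇒ `U(t) ≡ c` for `t ∈ [s,0)`, by the Oseen–Duhamel Abel bootstrap over the tree's
bounded-Picard slice estimate `exists_norm_oseenDuhamel_le_mul` and slab bilinearity `oseenDuhamel_self_sub_self`).
No `sorry`, no new axioms, no definitions.
-/

noncomputable section
set_option linter.dupNamespace false
open MeasureTheory Set Function Filter Metric Real InnerProductSpace
open _root_.Topology
open scoped ENNReal NNReal RealInnerProductSpace ContDiff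
open Literature.Analysis Literature.Analysis.FluidPDE Literature.Analysis.FluidPDE.LocalTypeIBlowup

namespace Summit.NavierStokesRegularity.NavierStokesRegularity.Theorems.StrainDoors

/-! ### §M32(a) The zoom at a singular point with the slice placed at `−4q²` -/

/-- ★★ **ZOOM AT A SINGULAR POINT ALONG A SEQUENCE OF TIMES, WITH THE SLICE PLACED AT `−4q²`.**
The tree's Barker–Prange zoom (`exists_zoomLimit_at_singular_along`, R68 `…₆₈`) with one more parameter
`q ≥ 1`: for a classical Leray–Hopf solution on `[0,T)` with the global sup-norm Type-I bound `|u| ≤ M/√(T − t)`,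
a backward singular point `(T,x₀)` and times `s n → T` in `(0,T)`, the zoom with the scales
`λ_j = √(T − s (φ j))/(2q)` — so that the slice `s (φ j)` sits at the rescaled time `−4q²` — converges along a
subsequence, POINTWISE at every rescaled time `σ < −1` together with its vorticity, to a member `U` of the
Type-I ancient mild class `A_M` (`IsTypeIAncientMild M U`):
`λ_j u(T + λ_j² σ, x₀ + λ_j y) → U(σ,y)` and `λ_j² ω(T + λ_j² σ, x₀ + λ_j y) → curl U(σ)(y)`.
Proof = the tree engine `LocalTypeIBlowup.exists_typeIAncientMild_zoomLimit` at the vertex after the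
Seregin–Šverák normalisation, verbatim as in `exists_zoomLimit_at_singular_along₆₈` but with the scales divided
by `q` (any positive null sequence of scales is admissible).
[cite: BarkerPrange2020Alignment, §4 proof of Thm. 1 Steps 1–3 (arXiv:1906.08225 pp. 16–17); AlbrittonBarker2019, Lemma 2.5] -/
theorem exists_zoomLimit_at_singular_along_scaled
    {T M : ℝ} {u : ℝ → (EuclideanSpace ℝ (Fin 3)) → (EuclideanSpace ℝ (Fin 3))}
    {p : ℝ → (EuclideanSpace ℝ (Fin 3)) → ℝ} (hT : 0 < T)
    (hcl : IsClassicalNSSolutionOn (Ico 0 T) 1 0 u p) (hLH : IsLerayHopfOn T 1 0 (u 0) u)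
    (hI : ∀ t ∈ Ioo 0 T, ∀ x : EuclideanSpace ℝ (Fin 3), ‖u t x‖ ≤ M / Real.sqrt (T - t))
    {x₀ : EuclideanSpace ℝ (Fin 3)} (hsing : IsBackwardSingularPoint u (T, x₀))
    {s : ℕ → ℝ} (hs : ∀ n, s n ∈ Ioo 0 T) (hsT : Tendsto s atTop (𝓝 T)) {q : ℝ} (hq : 1 ≤ q) :
    ∃ φ : ℕ → ℕ, StrictMono φ ∧
      ∃ U : ℝ → (EuclideanSpace ℝ (Fin 3)) → (EuclideanSpace ℝ (Fin 3)), IsTypeIAncientMild M U ∧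
        (∀ σ : ℝ, σ < -1 → ∀ y : EuclideanSpace ℝ (Fin 3),
          Tendsto (fun j => (Real.sqrt (T - s (φ j)) / (2 * q)) •
              u (T + (Real.sqrt (T - s (φ j)) / (2 * q)) ^ 2 * σ) (x₀ + (Real.sqrt (T - s (φ j)) / (2 * q)) • y))
            atTop (𝓝 (U σ y))) ∧
        ∀ σ : ℝ, σ < -1 → ∀ y : EuclideanSpace ℝ (Fin 3),
          Tendsto (fun j => (Real.sqrt (T - s (φ j)) / (2 * q)) ^ 2 •
              curl (u (T + (Real.sqrt (T - s (φ j)) / (2 * q)) ^ 2 * σ)) (x₀ + (Real.sqrt (T - s (φ j)) / (2 * q)) • y))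
            atTop (𝓝 (curl (U σ) y)) := by
  have hq0 : 0 < q := lt_of_lt_of_le one_pos hq
  -- ## Step 1: the class at the vertex and `𝐈 < ∞` from the rate
  set ρ : ℝ := Real.sqrt T / 2 with hρdef
  have hρ : 0 < ρ := by rw [hρdef]; positivity
  have hρ2 : ρ ^ 2 = T / 4 := by
    rw [hρdef, div_pow, Real.sq_sqrt hT.le]; norm_num
  have hρT : ρ ^ 2 ≤ T := by rw [hρ2]; linarith
  set pg : ℝ → (EuclideanSpace ℝ (Fin 3)) → ℝ := fun t x => p t x - (p t 0 - normalisedPressure (u t) 0) with hpg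
  have hballρ : IsSuitableWeakSolutionInBall ρ ((T, x₀) : ℝ × (EuclideanSpace ℝ (Fin 3))) u pg :=
    SereginSverak2002.isSuitableWeakSolutionInBall_vertex hT hcl hLH x₀ hρT
  -- zoom by `ρ` to the unit ball
  set ut : ℝ → (EuclideanSpace ℝ (Fin 3)) → (EuclideanSpace ℝ (Fin 3)) := ρ • stPull (ρ ^ 2) ρ T x₀ u with hut
  set pt : ℝ → (EuclideanSpace ℝ (Fin 3)) → ℝ := ρ ^ 2 • stPull (ρ ^ 2) ρ T x₀ pg with hpt
  have hball1 : IsSuitableWeakSolutionInBall 1 (0 : ℝ × (EuclideanSpace ℝ (Fin 3))) ut pt := by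
    have h := hballρ.zoom hρ
    simpa only using h
  obtain ⟨G₁, hG₁, -⟩ := hball1.2.2.1
  have hrate1 : ∀ t' x', (t', x') ∈ parabolicCylinder 1 (0 : ℝ × (EuclideanSpace ℝ (Fin 3))) →
      ‖ut t' x'‖ ≤ M / Real.sqrt ((0 : ℝ × (EuclideanSpace ℝ (Fin 3))).1 - t') := by
    intro t' x' hmem
    rw [mem_parabolicCylinder] at hmem
    simp only [Prod.fst_zero, Prod.snd_zero, zero_sub, one_pow, dist_zero_right] at hmem
    obtain ⟨⟨ht1, ht0⟩, -⟩ := hmem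
    have ht' : 0 < -t' := by linarith
    have hτ : T + ρ ^ 2 * t' ∈ Ioo 0 T := by
      rw [hρ2]
      constructor <;> nlinarith
    have h := hI _ hτ (x₀ + ρ • x')
    have hsq : Real.sqrt (T - (T + ρ ^ 2 * t')) = ρ * Real.sqrt (-t') := by
      rw [show T - (T + ρ ^ 2 * t') = ρ ^ 2 * (-t') by ring, Real.sqrt_mul (sq_nonneg _), Real.sqrt_sq hρ.le]
    rw [hsq] at h
    have hspos : 0 < Real.sqrt (-t') := Real.sqrt_pos.2 ht'
    simp only [Prod.fst_zero, zero_sub]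
    show ‖(ρ • stPull (ρ ^ 2) ρ T x₀ u) t' x'‖ ≤ M / Real.sqrt (-t')
    rw [smul_stPull_apply, norm_smul, Real.norm_of_nonneg hρ.le, le_div_iff₀ hspos]
    have h' := (le_div_iff₀ (mul_pos hρ hspos)).1 h
    calc ρ * ‖u (T + ρ ^ 2 * t') (x₀ + ρ • x')‖ * Real.sqrt (-t')
        = ‖u (T + ρ ^ 2 * t') (x₀ + ρ • x')‖ * (ρ * Real.sqrt (-t')) := by ring
      _ ≤ M := h'
  have hIhalf : typeIBound (parabolicCylinder (1 / 2) (0 : ℝ × (EuclideanSpace ℝ (Fin 3)))) ut pt G₁ < ⊤ :=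
    albrittonBarker2019_lemma_2_5_rate_holds 0 ut pt M hball1 hrate1 G₁ hG₁ (1 / 2) (by norm_num) (by norm_num)
  have hballh : IsSuitableWeakSolutionInBall (1 / 2) (0 : ℝ × (EuclideanSpace ℝ (Fin 3))) ut pt :=
    SuitableCompactness.isSuitableWeakSolutionInBall_of_le_radius hball1 (by norm_num) (by norm_num)
  have hle : parabolicCylinderOpens (1 / 2) (0 : ℝ × (EuclideanSpace ℝ (Fin 3))) ≤
      parabolicCylinderOpens 1 (0 : ℝ × (EuclideanSpace ℝ (Fin 3))) :=
    parabolicCylinder_mono (by norm_num) (by norm_num) _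
  have hwgh : HasWeakSpatialGradientOn (parabolicCylinderOpens (1 / 2) (0 : ℝ × (EuclideanSpace ℝ (Fin 3)))) ut G₁ :=
    hG₁.mono hle
  have hrateh : ∀ (t' : ℝ) (x' : EuclideanSpace ℝ (Fin 3)),
      (t', x') ∈ parabolicCylinder (1 / 2) (0 : ℝ × (EuclideanSpace ℝ (Fin 3))) →
        ‖ut t' x'‖ ≤ M / Real.sqrt ((0 : ℝ × (EuclideanSpace ℝ (Fin 3))).1 - t') :=
    fun t' x' h => hrate1 t' x' (hle h)
  -- continuity of the zoom on the half ball (the classical solution is smooth on `[0, T) × ℝ³`)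
  have hmaps : MapsTo (stAffine (ρ ^ 2) ρ T x₀)
      (parabolicCylinder (1 / 2) (0 : ℝ × (EuclideanSpace ℝ (Fin 3)))) (Ico 0 T ×ˢ univ) := by
    rintro ⟨t', x'⟩ hmem
    rw [mem_parabolicCylinder] at hmem
    simp only [Prod.fst_zero, Prod.snd_zero, zero_sub, dist_zero_right] at hmem
    obtain ⟨⟨ht1, ht0⟩, -⟩ := hmem
    rw [stAffine_apply]
    refine ⟨⟨?_, ?_⟩, mem_univ _⟩
    · rw [hρ2]; nlinarith
    · rw [hρ2]; nlinarith
  have hconth : ContinuousOn (uncurry ut) (parabolicCylinder (1 / 2) (0 : ℝ × (EuclideanSpace ℝ (Fin 3)))) := by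
    have e : uncurry ut = fun w => ρ • (uncurry u ∘ stAffine (ρ ^ 2) ρ T x₀) w := by
      funext w
      rfl
    rw [e]
    exact ContinuousOn.const_smul
      (hcl.smooth_velocity.continuousOn.comp (continuous_stAffine _ _ _ _).continuousOn hmaps) ρ
  -- the vertex stays singular
  have hst1 : stAffine (ρ ^ 2) ρ T x₀ (0 : ℝ × (EuclideanSpace ℝ (Fin 3))) =
      ((T, x₀) : ℝ × (EuclideanSpace ℝ (Fin 3))) := by
    rw [show (0 : ℝ × (EuclideanSpace ℝ (Fin 3))) = ((0 : ℝ), (0 : EuclideanSpace ℝ (Fin 3))) from rfl,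
      stAffine_apply, mul_zero, add_zero, smul_zero, add_zero]
  have hsing1 : IsBackwardSingularPoint ut 0 := by
    intro r hr
    rw [hut, eLpNorm_top_nsZoom hρ T x₀ r 0 u, hst1, hsing (ρ * r) (mul_pos hρ hr),
      ENNReal.mul_top (ENNReal.ofReal_pos.2 hρ).ne']
  -- ## Steps 2–3: the zoom along the scales `R n = √(T - s n) / (2qρ)`
  set R : ℕ → ℝ := fun n => Real.sqrt (T - s n) / (2 * q * ρ) with hRdef
  have hTs : ∀ n, 0 < T - s n := fun n => by linarith [(hs n).2]
  have hR : ∀ n, 0 < R n := fun n => by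
    rw [hRdef]
    exact div_pos (Real.sqrt_pos.2 (hTs n)) (by positivity)
  have hR0 : Tendsto R atTop (𝓝 0) := by
    have h1 : Tendsto (fun n => T - s n) atTop (𝓝 0) := by
      have h : Tendsto (fun n => T - s n) atTop (𝓝 (T - T)) := tendsto_const_nhds.sub hsT
      rwa [sub_self] at h
    have h2 : Tendsto (fun n => Real.sqrt (T - s n)) atTop (𝓝 0) := by
      have h := (Real.continuous_sqrt.tendsto 0).comp h1
      rwa [Function.comp_def, Real.sqrt_zero] at h
    have h3 := h2.div_const (2 * q * ρ)
    rwa [zero_div] at h3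
  obtain ⟨φ, hφ, U, P, H, hU, -, -, -, -, hconv, hcurl⟩ :=
    exists_typeIAncientMild_zoomLimit (z₀ := (0 : ℝ × (EuclideanSpace ℝ (Fin 3)))) (by norm_num : (0 : ℝ) < 1 / 2)
      hballh hwgh hIhalf hconth hrateh hsing1 hR hR0
  have e3 : ∀ j, ρ * R (φ j) = Real.sqrt (T - s (φ j)) / (2 * q) := fun j => by
    rw [hRdef]
    dsimp only
    field_simp
  have e4 : ∀ (j) (σ : ℝ), ρ ^ 2 * (R (φ j) ^ 2 * σ) = (Real.sqrt (T - s (φ j)) / (2 * q)) ^ 2 * σ := fun j σ => by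
    rw [← e3 j]
    ring
  have e1 : ∀ j, R (φ j) ^ 2 * (ρ * ρ) = (Real.sqrt (T - s (φ j)) / (2 * q)) ^ 2 := fun j => by
    rw [← e3 j]
    ring
  refine ⟨φ, hφ, U, hU, fun σ hσ y => ?_, fun σ hσ y => ?_⟩
  · have h := hconv σ hσ y
    refine h.congr fun j => ?_
    simp only [Prod.fst_zero, Prod.snd_zero, zero_add]
    show R (φ j) • (ρ • stPull (ρ ^ 2) ρ T x₀ u) (R (φ j) ^ 2 * σ) (R (φ j) • y) = _
    rw [smul_stPull_apply, smul_smul, smul_smul, e4, mul_comm (R (φ j)) ρ, e3]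
  · have h := hcurl σ hσ y
    refine h.congr fun j => ?_
    simp only [Prod.fst_zero, Prod.snd_zero, zero_add]
    show R (φ j) ^ 2 • curl ((ρ • stPull (ρ ^ 2) ρ T x₀ u) (R (φ j) ^ 2 * σ)) (R (φ j) • y) = _
    rw [curl_smul_stPull, smul_smul, smul_smul, e1, e4, e3]

/-! ### §M32(b) Forward uniqueness of a constant slice in the Type-I ancient mild class -/

/-- ★★ **LEMMA F — A CONSTANT SLICE PROPAGATES FORWARD IN `A_C`.**  If `U ∈ A_C`
(`IsTypeIAncientMild C U`) and the slice `U(s,·)` is the constant `c`, then `U(t,·) ≡ c` for every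
`t ∈ [s, 0)`.  Proof (Leray 1934 §19 / Kato: uniqueness of bounded mild solutions, run forward from
the constant datum): by the Oseen integral equation `U(t) = e^{(t−s)Δ}U(s) − B_s(U,U)(t)` and
`e^{σΔ}c = c`, `B_s(c,c) = 0` (the Oseen kernel has zero mean, `oseenDuhamel_eq_zero_of_const`),
`U(t) − c = −(B_s(U − c, U)(t) + B_s(c, U − c)(t))` (slab bilinearity, `oseenDuhamel_self_sub_self`), and the
slice estimate `‖B_s(a,b)(t)‖_∞ ≤ K ‖a‖_∞ ‖b‖_∞ · 2√(t − s)` (`exists_norm_oseenDuhamel_le_mul`) contracts the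
sup of `‖U − c‖` on a block of length `ℓ` with `8 K B √ℓ ≤ 1` (`B = C/√(−t)` bounds `U` and `c` on `[s,t]`):
the sup is `≤ 2B·2^{−n}` for every `n`, hence zero; finitely many blocks of the same length reach `t`.
[cite: Leray1934, §19 (3.4)–(3.8); KochNadirashviliSereginSverak2009, Remark 6.1 (arXiv:0709.3599 p. 11)] -/
theorem typeIAncientMild_forward_const {C : ℝ}
    {U : ℝ → EuclideanSpace ℝ (Fin 3) → EuclideanSpace ℝ (Fin 3)} (hU : IsTypeIAncientMild C U)
    {s : ℝ} {c : EuclideanSpace ℝ (Fin 3)} (hc : ∀ x, U s x = c)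
    {t : ℝ} (hst : s ≤ t) (ht : t < 0) (x : EuclideanSpace ℝ (Fin 3)) : U t x = c := by
  obtain ⟨K, hK, hKB⟩ := exists_norm_oseenDuhamel_le_mul (E := EuclideanSpace ℝ (Fin 3))
  -- the common bound `B = C/√(−t)` of `U` and `c` on `[s, t]`
  set B : ℝ := C / Real.sqrt (-t) with hBdef
  have hC : 0 ≤ C := hU.nonneg
  have hB0 : 0 ≤ B := by rw [hBdef]; positivity
  have hUB : ∀ τ, s ≤ τ → τ ≤ t → ∀ y, ‖U τ y‖ ≤ B := by
    intro τ hsτ hτt y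
    have hτ : τ < 0 := lt_of_le_of_lt hτt ht
    have h1 := hU.norm_le hτ y
    have h2 : C / Real.sqrt (-τ) ≤ B := by
      rw [hBdef]
      have hst' : Real.sqrt (-t) ≤ Real.sqrt (-τ) := Real.sqrt_le_sqrt (by linarith)
      have hpos : 0 < Real.sqrt (-t) := Real.sqrt_pos.2 (by linarith)
      exact div_le_div_of_nonneg_left hC hpos hst'
    exact h1.trans h2
  have hcB : ‖c‖ ≤ B := by rw [← hc 0]; exact hUB s le_rfl hst 0
  -- the block length
  set ℓ : ℝ := (1 / (8 * K * B + 1)) ^ 2 with hℓdef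
  have h8 : 0 < 8 * K * B + 1 := by positivity
  have hℓ : 0 < ℓ := by rw [hℓdef]; positivity
  have hsqℓ : Real.sqrt ℓ = 1 / (8 * K * B + 1) := by
    rw [hℓdef, Real.sqrt_sq (by positivity)]
  have hcontr : 8 * K * B * Real.sqrt ℓ ≤ 1 := by
    rw [hsqℓ, mul_one_div, div_le_one h8]
    linarith
  -- ### one block: constancy on `(a, b]` from constancy at `a`, when `b − a ≤ ℓ`
  have block : ∀ a b : ℝ, s ≤ a → a < b → b ≤ t → b - a ≤ ℓ → (∀ y, U a y = c) →
      ∀ τ ∈ Ioc a b, ∀ y, U τ y = c := by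
    intro a b hsa hab hbt hbaℓ hca
    have hb : b < 0 := lt_of_le_of_lt hbt ht
    have hsq : Real.sqrt (b - a) ≤ Real.sqrt ℓ := Real.sqrt_le_sqrt hbaℓ
    have hθ : 8 * K * B * Real.sqrt (b - a) ≤ 1 :=
      (mul_le_mul_of_nonneg_left hsq (by positivity)).trans hcontr
    -- measurability on the slab `(a, b) × ℝ³`
    have hmU : AEStronglyMeasurable (uncurry U)
        ((volume : Measure (ℝ × EuclideanSpace ℝ (Fin 3))).restrict (Ioo a b ×ˢ univ)) :=
      hU.aestronglyMeasurable_uncurry hb.le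
    have hmK : AEStronglyMeasurable (uncurry (fun (_ : ℝ) (_ : EuclideanSpace ℝ (Fin 3)) => c))
        ((volume : Measure (ℝ × EuclideanSpace ℝ (Fin 3))).restrict (Ioo a b ×ˢ univ)) :=
      (aestronglyMeasurable_const : AEStronglyMeasurable (fun _ : ℝ × EuclideanSpace ℝ (Fin 3) => c) _)
    have hUab : ∀ τ ∈ Ioo a b, ∀ y, ‖U τ y‖ ≤ B := fun τ hτ y => hUB τ (hsa.trans hτ.1.le) (hτ.2.le.trans hbt) y
    have hKab : ∀ τ ∈ Ioo a b, ∀ y : EuclideanSpace ℝ (Fin 3),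
        ‖(fun (_ : ℝ) (_ : EuclideanSpace ℝ (Fin 3)) => c) τ y‖ ≤ B := fun _ _ _ => hcB
    -- the representation `U(τ) − c = −(B_a(U − c, U)(τ) + B_a(c, U − c)(τ))`
    have hrepr : ∀ τ ∈ Ioc a b, ∀ y, U τ y - c =
        -(oseenDuhamel 1 a (fun σ z => U σ z - c) U τ y +
          oseenDuhamel 1 a (fun (_ : ℝ) (_ : EuclideanSpace ℝ (Fin 3)) => c) (fun σ z => U σ z - c) τ y) := by
      intro τ hτ y
      have hτ0 : τ < 0 := lt_of_le_of_lt (hτ.2.trans hbt) ht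
      have hmild := hU.mild_eq_heatExtension hτ.1 hτ0 y
      have hUa : U a = fun _ => c := funext hca
      rw [hUa, UnboundedOperators.heatExtension_const _ (sub_pos.2 hτ.1)] at hmild
      have hzero : oseenDuhamel 1 a (fun (_ : ℝ) (_ : EuclideanSpace ℝ (Fin 3)) => c)
          (fun (_ : ℝ) (_ : EuclideanSpace ℝ (Fin 3)) => c) τ y = 0 :=
        oseenDuhamel_eq_zero_of_const (b := fun _ => c) (c := fun _ => c)
          (fun _ _ _ => rfl) (fun _ _ _ => rfl) y
      have hsplit := oseenDuhamel_self_sub_self (ν := (1 : ℝ)) one_pos hmU hmK hUab hKab hτ.1 hτ.2 y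
      rw [hzero, sub_zero] at hsplit
      rw [hmild, ← hsplit]
      abel
    -- the bootstrap
    have P : ∀ n : ℕ, ∀ τ ∈ Ioc a b, ∀ y, ‖U τ y - c‖ ≤ 2 * B * (1 / 2) ^ n := by
      intro n
      induction n with
      | zero =>
        intro τ hτ y
        rw [pow_zero, mul_one]
        have h1 : ‖U τ y‖ ≤ B := hUB τ (hsa.trans hτ.1.le) (hτ.2.trans hbt) y
        calc ‖U τ y - c‖ ≤ ‖U τ y‖ + ‖c‖ := norm_sub_le _ _
          _ ≤ 2 * B := by linarith
      | succ n ih =>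
        intro τ hτ y
        have hτ0 : τ < 0 := lt_of_le_of_lt (hτ.2.trans hbt) ht
        have han : 0 ≤ 2 * B * (1 / 2) ^ n := by positivity
        have hd : ∀ σ ∈ Ioo a τ, ∀ z, ‖(fun σ z => U σ z - c) σ z‖ ≤ 2 * B * (1 / 2) ^ n :=
          fun σ hσ z => ih σ ⟨hσ.1, hσ.2.le.trans hτ.2⟩ z
        have hu : ∀ σ ∈ Ioo a τ, ∀ z, ‖U σ z‖ ≤ B :=
          fun σ hσ z => hUB σ (hsa.trans hσ.1.le) ((hσ.2.le.trans hτ.2).trans hbt) z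
        have hk : ∀ σ ∈ Ioo a τ, ∀ z : EuclideanSpace ℝ (Fin 3),
            ‖(fun (_ : ℝ) (_ : EuclideanSpace ℝ (Fin 3)) => c) σ z‖ ≤ B := fun _ _ _ => hcB
        have e1 := hKB one_pos hτ.1 han hB0 hd hu y
        have e2 := hKB one_pos hτ.1 hB0 han hk hd y
        rw [Real.one_rpow, mul_one] at e1 e2
        have hsq : Real.sqrt (τ - a) ≤ Real.sqrt (b - a) := Real.sqrt_le_sqrt (by linarith [hτ.2])
        have hsq0 : 0 ≤ Real.sqrt (τ - a) := Real.sqrt_nonneg _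
        rw [hrepr τ hτ y, norm_neg]
        calc ‖oseenDuhamel 1 a (fun σ z => U σ z - c) U τ y +
              oseenDuhamel 1 a (fun (_ : ℝ) (_ : EuclideanSpace ℝ (Fin 3)) => c) (fun σ z => U σ z - c) τ y‖
            ≤ K * (2 * B * (1 / 2) ^ n) * B * (2 * Real.sqrt (τ - a)) +
                K * B * (2 * B * (1 / 2) ^ n) * (2 * Real.sqrt (τ - a)) :=
              (norm_add_le _ _).trans (add_le_add e1 e2)
          _ = (8 * K * B * Real.sqrt (τ - a)) * (B * (1 / 2) ^ n) := by ring
          _ ≤ (8 * K * B * Real.sqrt (b - a)) * (B * (1 / 2) ^ n) := by gcongr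
          _ ≤ 1 * (B * (1 / 2) ^ n) := by gcongr
          _ = 2 * B * (1 / 2) ^ (n + 1) := by ring
    -- conclusion of the block
    intro τ hτ y
    have hlim : Tendsto (fun n : ℕ => 2 * B * (1 / 2 : ℝ) ^ n) atTop (𝓝 (2 * B * 0)) :=
      (tendsto_pow_atTop_nhds_zero_of_lt_one (by norm_num) (by norm_num)).const_mul (2 * B)
    rw [mul_zero] at hlim
    have h0 : ‖U τ y - c‖ ≤ 0 :=
      ge_of_tendsto hlim (Eventually.of_forall fun n => P n τ hτ y)
    exact sub_eq_zero.1 (norm_le_zero_iff.1 h0)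
  -- ### chaining the blocks
  have chain : ∀ k : ℕ, ∀ τ, s ≤ τ → τ ≤ min (s + k * ℓ) t → ∀ y, U τ y = c := by
    intro k
    induction k with
    | zero =>
      intro τ hsτ hτ y
      have hτs : τ ≤ s := hτ.trans ((min_le_left _ _).trans (by simp))
      rw [le_antisymm hτs hsτ]
      exact hc y
    | succ k ih =>
      intro τ hsτ hτ y
      by_cases hle : τ ≤ min (s + k * ℓ) t
      · exact ih τ hsτ hle y
      · push Not at hle
        set a : ℝ := min (s + k * ℓ) t with hadef
        have hsa : s ≤ a := le_min (by nlinarith [hℓ.le, (k.cast_nonneg : (0 : ℝ) ≤ k)]) hst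
        have hca : ∀ z, U a z = c := fun z => ih a hsa le_rfl z
        have hτt : τ ≤ t := hτ.trans (min_le_right _ _)
        have hτa : τ ≤ a + ℓ := by
          rcases le_total (s + k * ℓ) t with h | h
          · have ha : a = s + k * ℓ := min_eq_left h
            rw [ha]
            have := hτ.trans (min_le_left _ _)
            push_cast at this
            linarith
          · have ha : a = t := min_eq_right h
            rw [ha]; linarith
        exact block a τ hsa hle hτt (by linarith) hca τ ⟨hle, le_rfl⟩ y
  -- ### reach `t`
  obtain ⟨k, hk⟩ : ∃ k : ℕ, (t - s) / ℓ ≤ k := exists_nat_ge _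
  have hkt : t ≤ s + k * ℓ := by
    have := (div_le_iff₀ hℓ).1 hk
    linarith
  exact chain k t hst (le_min hkt le_rfl) x

end Summit.NavierStokesRegularity.NavierStokesRegularity.Theorems.StrainDoors

end
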